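import Summits.Ventures.HodgeRepro2.T5SU11SphericalCfunLimit
import Summits.Ventures.HodgeRepro2.T5CircleFourierProjector

/-!
# Strict Jensen for the spherical functions of `SU(1,1)`: `φ_λ(g) < 1` for `0 < λ < 2` and `g ∉ K`,
`φ_λ(g) > 1` for `λ ∉ [0, 2]` and `g ∉ K`; `φ_λ(g) = 1` iff `λ ∈ {0, 2}` or `g ∈ K`

The Jensen bounds of `T5SU11SphericalBounds` (`sph λ ≤ 1` on `0 ≤ λ ≤ 2`, `≥ 1` outside) come from the
probability measure `dk` on `K` and the identity `∫_K P_t(u) dk = 1` for the Poisson integrand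
`P_t(u) = |cosh t - ū² sinh t|^{-2}`. Mathlib's strict Jensen inequality
(`StrictConcaveOn.ae_eq_const_or_lt_map_average`, `StrictConvexOn.ae_eq_const_or_map_average_lt`) makes
them strict as soon as `P_t` is not a.e. constant: `P_t` is continuous and `dk` charges every open set
(`haarCircle` is a Haar measure, `T5CircleFourierProjector`), so an a.e. constant `P_t` would be constant
(`Continuous.ae_eq_iff_eq`), but `P_t(1) = e^{2t}` and `P_t(i) = e^{-2t}` (`kint_one`,
`kint_exp_pi_div_two`: `ī² = -1`, `conj_coe_exp_pi_div_two_sq`), which differ for `t ≠ 0`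
(`not_ae_const_kint`). Hence **`sph λ (a_t) < 1` for `0 < λ < 2`, `t ≠ 0`** (`sph_hyp_lt_one`, the
strictly concave power `x ↦ x^{λ/2}`), **`sph λ (a_t) > 1` for `λ > 2`** (`one_lt_sph_hyp_of_two_lt`, the
strictly convex power) **and for `λ < 0`** (`one_lt_sph_hyp_of_neg`, the functional equation); on the
group, with `g ∉ K ⟺ cartanT g ≠ 0`: `sph_lt_one`, `one_lt_sph`, and the characterisation
**`sph λ g = 1 ↔ λ = 0 ∨ λ = 2 ∨ cartanT g = 0`** (`sph_eq_one_iff`); for Harish-Chandra's `Ξ = φ₁`: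
`Ξ(g) < 1` off `K` and `Ξ(g) = 1 ↔ g ∈ K` (`sph_one_lt_one`, `sph_one_eq_one_iff`). Nothing is claimed
about (N).

Blind lane: Mathlib + the HodgeRepro2 prefix only; no sorry; axioms ⊆ {propext, Classical.choice,
Quot.sound}.
-/

namespace Summit.Ventures.HodgeRepro2.T5SU11SphericalStrict

open MeasureTheory Metric Set Filter Topology Complex
open T5SU11Unimodular T5SU11Fibration T5SU11Cartan T5SU11OneParameter T5SU11CartanProjection
  T5HaarCircle T5BergmanCoefficient T5SU11SphericalFunction T5SU11SphericalTwo
  T5SU11SphericalSymmetry T5SU11SphericalBounds T5SU11SphericalContinuous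
  T5SU11SphericalAsymptotic T5SU11SphericalLp T5SU11SphericalCfun T5SU11SphericalLpSharp
  T5SU11SphericalXiLog T5SU11SphericalCfunLimit
open scoped Real

/-! ### Two values of the Poisson integrand on `K` -/

/-- At `u = 1`: `|cosh t - 1̄² sinh t| = e^{-t}`. -/
lemma kint_one (t : ℝ) :
    ‖(Real.cosh t : ℂ) - (starRingEnd ℂ) ((1 : Circle) : ℂ) ^ 2 * Real.sinh t‖ = Real.exp (-t) := by
  rw [Circle.coe_one, map_one, one_pow, one_mul, ← Complex.ofReal_sub, Complex.norm_real,
    Real.norm_eq_abs, Real.cosh_sub_sinh, abs_of_pos (Real.exp_pos _)]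

/-- `conj (e^{iπ/2})² = -1`. -/
lemma conj_coe_exp_pi_div_two_sq :
    (starRingEnd ℂ) ((Circle.exp (π / 2) : Circle) : ℂ) ^ 2 = -1 := by
  rw [Circle.coe_exp, ← Complex.exp_conj, map_mul, Complex.conj_ofReal, Complex.conj_I,
    ← Complex.exp_nat_mul, show ((2 : ℕ) : ℂ) * (((π / 2 : ℝ) : ℂ) * -Complex.I) = -(π * Complex.I) by
      push_cast; ring,
    Complex.exp_neg, Complex.exp_pi_mul_I, inv_neg, inv_one]

/-- At `u = e^{iπ/2} = i`: `|cosh t - ī² sinh t| = |cosh t + sinh t| = e^{t}`. -/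
lemma kint_exp_pi_div_two (t : ℝ) :
    ‖(Real.cosh t : ℂ) - (starRingEnd ℂ) ((Circle.exp (π / 2) : Circle) : ℂ) ^ 2 * Real.sinh t‖ =
      Real.exp t := by
  rw [conj_coe_exp_pi_div_two_sq, neg_one_mul, sub_neg_eq_add, ← Complex.ofReal_add,
    Complex.norm_real, Real.norm_eq_abs, Real.cosh_add_sinh, abs_of_pos (Real.exp_pos _)]

section measure

variable [MeasurableSpace Circle] [BorelSpace Circle]

/-- **The Poisson integrand is not a.e. constant on `K` for `t ≠ 0`.** -/
theorem not_ae_const_kint {t : ℝ} (ht : t ≠ 0) (c : ℝ) :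
    ¬ ((fun u : Circle => ‖(Real.cosh t : ℂ) - (starRingEnd ℂ) (u : ℂ) ^ 2 * Real.sinh t‖ ^ (-(2 : ℝ)))
      =ᵐ[haarCircle] Function.const Circle c) := by
  intro h
  have h' := (Continuous.ae_eq_iff_eq haarCircle (continuous_kint_rpow t (-(2 : ℝ)))
    (continuous_const (y := c))).mp h
  have h1 : ‖(Real.cosh t : ℂ) - (starRingEnd ℂ) ((1 : Circle) : ℂ) ^ 2 * Real.sinh t‖ ^ (-(2 : ℝ)) =
      c := congrFun h' 1
  have h2 : ‖(Real.cosh t : ℂ) - (starRingEnd ℂ) ((Circle.exp (π / 2) : Circle) : ℂ) ^ 2 *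
      Real.sinh t‖ ^ (-(2 : ℝ)) = c := congrFun h' (Circle.exp (π / 2))
  rw [kint_one] at h1
  rw [kint_exp_pi_div_two] at h2
  rw [← h2, ← Real.exp_mul, ← Real.exp_mul, Real.exp_eq_exp] at h1
  exact ht (by linarith)

/-- **Strict Jensen: `sph λ (a_t) < 1` for `0 < λ < 2` and `t ≠ 0`** (the strictly concave power
`x ↦ x^{λ/2}`). -/
theorem sph_hyp_lt_one {lam : ℝ} (h0 : 0 < lam) (h2 : lam < 2) {t : ℝ} (ht : t ≠ 0) :
    sph lam (hyp t) < 1 := by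
  rw [sph_hyp]
  have hcc : StrictConcaveOn ℝ (Ici 0) fun x : ℝ => x ^ (lam / 2) :=
    Real.strictConcaveOn_rpow (by linarith) (by linarith)
  have hgi : Integrable ((fun x : ℝ => x ^ (lam / 2)) ∘ fun u : Circle =>
      ‖(Real.cosh t : ℂ) - (starRingEnd ℂ) (u : ℂ) ^ 2 * Real.sinh t‖ ^ (-(2 : ℝ))) haarCircle := by
    have e : ((fun x : ℝ => x ^ (lam / 2)) ∘ fun u : Circle =>
        ‖(Real.cosh t : ℂ) - (starRingEnd ℂ) (u : ℂ) ^ 2 * Real.sinh t‖ ^ (-(2 : ℝ))) =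
        fun u : Circle => ‖(Real.cosh t : ℂ) - (starRingEnd ℂ) (u : ℂ) ^ 2 * Real.sinh t‖ ^ (-lam) := by
      funext u
      simp only [Function.comp]
      exact (rpow_neg_eq_rpow_neg_two_rpow (kint_pos t u) lam).symm
    rw [e]
    exact integrable_kint_rpow t _
  rcases hcc.ae_eq_const_or_lt_map_average (μ := haarCircle)
    (f := fun u : Circle => ‖(Real.cosh t : ℂ) - (starRingEnd ℂ) (u : ℂ) ^ 2 * Real.sinh t‖ ^ (-(2 : ℝ)))
    (Real.continuous_rpow_const (by linarith)).continuousOn isClosed_Ici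
    (Filter.Eventually.of_forall fun u => Real.rpow_nonneg (norm_nonneg _) _)
    (integrable_kint_rpow t _) hgi with h | h
  · exact absurd h (not_ae_const_kint ht _)
  · rw [average_eq_integral, average_eq_integral, integral_kint_rpow_neg_two, Real.one_rpow] at h
    refine lt_of_eq_of_lt ?_ h
    congr 1
    funext u
    exact rpow_neg_eq_rpow_neg_two_rpow (kint_pos t u) lam

/-- **Strict Jensen: `sph λ (a_t) > 1` for `λ > 2` and `t ≠ 0`** (the strictly convex power). -/
theorem one_lt_sph_hyp_of_two_lt {lam : ℝ} (h2 : 2 < lam) {t : ℝ} (ht : t ≠ 0) :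
    1 < sph lam (hyp t) := by
  rw [sph_hyp]
  have hcv : StrictConvexOn ℝ (Ici 0) fun x : ℝ => x ^ (lam / 2) :=
    strictConvexOn_rpow (by linarith)
  have hgi : Integrable ((fun x : ℝ => x ^ (lam / 2)) ∘ fun u : Circle =>
      ‖(Real.cosh t : ℂ) - (starRingEnd ℂ) (u : ℂ) ^ 2 * Real.sinh t‖ ^ (-(2 : ℝ))) haarCircle := by
    have e : ((fun x : ℝ => x ^ (lam / 2)) ∘ fun u : Circle =>
        ‖(Real.cosh t : ℂ) - (starRingEnd ℂ) (u : ℂ) ^ 2 * Real.sinh t‖ ^ (-(2 : ℝ))) =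
        fun u : Circle => ‖(Real.cosh t : ℂ) - (starRingEnd ℂ) (u : ℂ) ^ 2 * Real.sinh t‖ ^ (-lam) := by
      funext u
      simp only [Function.comp]
      exact (rpow_neg_eq_rpow_neg_two_rpow (kint_pos t u) lam).symm
    rw [e]
    exact integrable_kint_rpow t _
  rcases hcv.ae_eq_const_or_map_average_lt (μ := haarCircle)
    (f := fun u : Circle => ‖(Real.cosh t : ℂ) - (starRingEnd ℂ) (u : ℂ) ^ 2 * Real.sinh t‖ ^ (-(2 : ℝ)))
    (Real.continuous_rpow_const (by linarith)).continuousOn isClosed_Ici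
    (Filter.Eventually.of_forall fun u => Real.rpow_nonneg (norm_nonneg _) _)
    (integrable_kint_rpow t _) hgi with h | h
  · exact absurd h (not_ae_const_kint ht _)
  · rw [average_eq_integral, average_eq_integral, integral_kint_rpow_neg_two, Real.one_rpow] at h
    refine lt_of_lt_of_eq h ?_
    congr 1
    funext u
    exact (rpow_neg_eq_rpow_neg_two_rpow (kint_pos t u) lam).symm

/-- **`sph λ (a_t) > 1` for `λ < 0` and `t ≠ 0`** (the functional equation `φ_λ = φ_{2-λ}`). -/
theorem one_lt_sph_hyp_of_neg {lam : ℝ} (h0 : lam < 0) {t : ℝ} (ht : t ≠ 0) :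
    1 < sph lam (hyp t) := by
  rw [sph_two_sub_hyp]
  exact one_lt_sph_hyp_of_two_lt (by linarith) ht

/-- **`sph λ g < 1` for `0 < λ < 2` and `g ∉ K`** (`cartanT g ≠ 0`). -/
theorem sph_lt_one {lam : ℝ} (h0 : 0 < lam) (h2 : lam < 2) {g : SU11} (hg : cartanT g ≠ 0) :
    sph lam g < 1 := by
  rw [sph_eq_sph_hyp_cartanT]
  exact sph_hyp_lt_one h0 h2 hg

/-- **`sph λ g > 1` for `λ < 0` or `λ > 2` and `g ∉ K`.** -/
theorem one_lt_sph {lam : ℝ} (h : lam < 0 ∨ 2 < lam) {g : SU11} (hg : cartanT g ≠ 0) :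
    1 < sph lam g := by
  rw [sph_eq_sph_hyp_cartanT]
  rcases h with h | h
  · exact one_lt_sph_hyp_of_neg h hg
  · exact one_lt_sph_hyp_of_two_lt h hg

/-- `sph λ g = 1` on `K`. -/
theorem sph_eq_one_of_cartanT_eq_zero (lam : ℝ) {g : SU11} (hg : cartanT g = 0) : sph lam g = 1 := by
  obtain ⟨u, rfl⟩ := (cartanT_eq_zero_iff g).mp hg
  exact sph_rot lam u

/-- **The equality cases: `sph λ g = 1` iff `λ = 0`, or `λ = 2`, or `g ∈ K`.** -/
theorem sph_eq_one_iff (lam : ℝ) (g : SU11) :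
    sph lam g = 1 ↔ lam = 0 ∨ lam = 2 ∨ cartanT g = 0 := by
  constructor
  · intro h
    by_contra hcon
    rw [not_or, not_or] at hcon
    obtain ⟨h0, h2, hg⟩ := hcon
    rcases lt_trichotomy lam 0 with hl | hl | hl
    · exact absurd h (one_lt_sph (Or.inl hl) hg).ne'
    · exact h0 hl
    · rcases lt_trichotomy lam 2 with hl2 | hl2 | hl2
      · exact absurd h (sph_lt_one hl hl2 hg).ne
      · exact h2 hl2
      · exact absurd h (one_lt_sph (Or.inr hl2) hg).ne'
  · rintro (rfl | rfl | hg)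
    · exact sph_zero g
    · exact sph_two g
    · exact sph_eq_one_of_cartanT_eq_zero lam hg

/-- **Harish-Chandra's `Ξ = φ₁` is `< 1` off `K`.** -/
theorem sph_one_lt_one {g : SU11} (hg : cartanT g ≠ 0) : sph 1 g < 1 :=
  sph_lt_one zero_lt_one one_lt_two hg

/-- **`Ξ(g) = 1` iff `g ∈ K`.** -/
theorem sph_one_eq_one_iff (g : SU11) : sph 1 g = 1 ↔ ∃ u : Circle, g = rot u := by
  rw [sph_eq_one_iff, ← cartanT_eq_zero_iff]
  constructor
  · rintro (h | h | h)
    · norm_num at h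
    · norm_num at h
    · exact h
  · intro h
    exact Or.inr (Or.inr h)

/-- **`Ξ(a_t) < 1` for `t ≠ 0`.** -/
theorem sph_one_hyp_lt_one {t : ℝ} (ht : t ≠ 0) : sph 1 (hyp t) < 1 :=
  sph_hyp_lt_one zero_lt_one one_lt_two ht

end measure

end Summit.Ventures.HodgeRepro2.T5SU11SphericalStrict
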